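import Literature.Algebra.Homology.OrderedCechPairSystem
import Mathlib.Algebra.Homology.Monoidal
import Mathlib.Algebra.Homology.TotalComplex
import Mathlib.LinearAlgebra.TensorProduct.Pi
import HarnessLib

/-!
# `Č•(M) ⊗_A Č•(N) ≅ Tot Č•,•(M ⊠ N)`: the tensor product of two ordered Čech complexes is the total complex of the
# ordered Čech bicomplex of the product system (Stacks 0BEC, 012K)

Layer `Literature/Algebra/Homology` (constructions + proved lemmas; 0 named facts, no instance, no notation; pure homological
algebra over a commutative ring `A`). For finite linearly ordered `ι`, `κ` and systems of `A`-modules `M` on `Finset ι`, `N` on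
`Finset κ` (`Algebra/Homology/OrderedCechSystem`), with product pair-system `M ⊠ N = (s, t) ↦ M s ⊗_A N t` and ordered Čech
bicomplex `Č•,•(M ⊠ N)` (`Algebra/Homology/OrderedCechPairSystem.sysBicomplex`):

* **`tensorCochainEquiv : Čᵃ(M) ⊗_A Čᵇ(N) ≃ₗ[A] Čᵃ,ᵇ(M ⊠ N) = Π_τ Π_σ M σ ⊗ N τ`**, `f ⊗ g ↦ ((τ, σ) ↦ f σ ⊗ g τ)` — tensor
  products commute with FINITE products (Mathlib `TensorProduct.piRight` / `piLeft`); `tensorCochainEquiv_tmul`, and the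
  zero-extension formulas `ext0At_tensorCochainEquiv(_apply)` feeding the Čech differentials;
* `tensorBicomplex M N` — Mathlib's tensor bicomplex `(a, b) ↦ Čᵃ(M) ⊗ Čᵇ(N)` (outer differential `d_M ▷ –`, inner `– ◁ d_N`;
  its total complex is `HomologicalComplex.tensorObj Č(M) Č(N)` by definition), `tensorBicomplex_X_d_tmul`,
  `tensorBicomplex_d_f_tmul`;
* **`tensorBicomplexIso M N : tensorBicomplex M N ≅ sysBicomplex (prodSystem M N)`** — an isomorphism of BICOMPLEXES
  (termwise `tensorCochainEquiv`; both differentials match by linearity of `⊗` in each variable);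
* **`totalTensorIso M N : Č•(M) ⊗ Č•(N) ≅ Tot Č•,•(M ⊠ N)`** (`HomologicalComplex₂.total.mapIso`) — the algebraic half of "the
  Čech complex of a box product on the product covering is the tensor product of the Čech complexes" (The Stacks Project,
  Tag 0BEC, proof of the Künneth formula); the geometric half (the sections of `E ⊠ F` over `U_s ×_S V_t`, i.e.
  `Modules/BoxTensorAffineSectionsSecMod`) is not in this file.

Library only (cell `pub-hodge-ring2`, count-neutral); proves nothing about any crux, route or conjecture. Mathlib searched (pin
v4.32): `TensorProduct.piRight` (+ `piRightHom_tmul`), `TensorProduct.piLeft`, `Functor.mapBifunctorHomologicalComplex`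
(+ `_obj_obj_X_d`, `_obj_obj_d_f`), `curriedTensor_obj_map` / `curriedTensor_map_app`, `ModuleCat.MonoidalCategory.whiskerLeft_apply`
/ `whiskerRight_apply`, `HomologicalComplex.Hom.isoOfComponents`, `HomologicalComplex₂.total.mapIso` (used).

## References

* The Stacks Project, Tag 0BEC (Künneth formula), Tag 012K (double complexes and their totalisation). [StacksProject]
* U. Görtz, T. Wedhorn, *Algebraic Geometry II* (2023), Def. 21.68 (p. 180). [GortzWedhorn2023]
-/

universe u

open CategoryTheory MonoidalCategory TensorProduct

set_option backward.isDefEq.respectTransparency false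

noncomputable section

namespace Literature.Algebra.Homology

namespace OrderedCech

variable {A : Type u} [CommRing A] {ι κ : Type} [LinearOrder ι] [LinearOrder κ]

section Tensor

variable (M : Finset ι ⥤ ModuleCat.{u} A) (N : Finset κ ⥤ ModuleCat.{u} A)
variable [Fintype ι] [Fintype κ]

/-- **`Čᵃ(M) ⊗_A Čᵇ(N) ≃ₗ[A] Čᵃ,ᵇ(M ⊠ N) = Π_τ Π_σ M σ ⊗ N τ`**: tensor products commute with finite products
(Mathlib `TensorProduct.piRight`, `TensorProduct.piLeft`; `Simplex ι a`, `Simplex κ b` are finite).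
[cite: StacksProject, Tag 0BEC] -/
def tensorCochainEquiv (a b : ℤ) :
    SysCochain M a ⊗[A] SysCochain N b ≃ₗ[A] SysCochain (cochainSystem (prodSystem M N) a) b :=
  (TensorProduct.piRight A A (SysCochain M a) (fun τ : Simplex κ b => (N.obj τ.1 : Type u)) :
      SysCochain M a ⊗[A] SysCochain N b ≃ₗ[A] ∀ τ : Simplex κ b, SysCochain M a ⊗[A] N.obj τ.1) ≪≫ₗ
    (LinearEquiv.piCongrRight fun τ : Simplex κ b =>
      (TensorProduct.piLeft A (N.obj τ.1) (fun σ : Simplex ι a => (M.obj σ.1 : Type u)) :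
        SysCochain M a ⊗[A] N.obj τ.1 ≃ₗ[A] ∀ σ : Simplex ι a, M.obj σ.1 ⊗[A] N.obj τ.1) :
      (∀ τ : Simplex κ b, SysCochain M a ⊗[A] N.obj τ.1) ≃ₗ[A]
        ∀ τ : Simplex κ b, SysCochain ((prodSystem M N).flip.obj τ.1) a)

/-- On pure tensors: `f ⊗ g ↦ ((τ, σ) ↦ f σ ⊗ g τ)`. [cite: StacksProject, Tag 0BEC] -/
@[simp] theorem tensorCochainEquiv_tmul (a b : ℤ) (f : SysCochain M a) (g : SysCochain N b) (τ : Simplex κ b)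
    (σ : Simplex ι a) :
    (tensorCochainEquiv M N a b (f ⊗ₜ g) : ∀ τ : Simplex κ b, SysCochain ((prodSystem M N).flip.obj τ.1) a) τ σ =
      f σ ⊗ₜ g τ :=
  rfl

variable {M N} in
/-- Zero-extension of an image cochain, `τ`-direction: `(E(f ⊗ g)).ext0At s t σ = f σ ⊗ g.ext0At s t` for the
`κ`-system `cochainSystem (M ⊠ N) a`. [cite: GortzWedhorn2023, Def. 21.68 (p. 180)] -/
theorem ext0At_tensorCochainEquiv {a b : ℤ} (f : SysCochain M a) (g : SysCochain N b) (s t : Finset κ)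
    (σ : Simplex ι a) :
    ((tensorCochainEquiv M N a b (f ⊗ₜ g)).ext0At s t : SysCochain ((prodSystem M N).flip.obj t) a) σ =
      f σ ⊗ₜ g.ext0At s t := by
  unfold SysCochain.ext0At
  split_ifs with h
  · rw [cochainSystem_map_apply, sysCochainMap_apply]
    change (M.obj σ.1 ◁ N.map (homOfLE h.2))
      ((tensorCochainEquiv M N a b (f ⊗ₜ g) : ∀ τ : Simplex κ b, SysCochain ((prodSystem M N).flip.obj τ.1) a)
        ⟨s, h.1⟩ σ) = _
    rw [tensorCochainEquiv_tmul]
    rfl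
  · rw [tmul_zero]
    rfl

variable {M N} in
/-- Zero-extension of an image cochain, `σ`-direction: `(E(f ⊗ g) τ).ext0At s t = f.ext0At s t ⊗ g τ` for the
`ι`-system `(M ⊠ N)(·, τ)`. [cite: GortzWedhorn2023, Def. 21.68 (p. 180)] -/
theorem ext0At_tensorCochainEquiv_apply {a b : ℤ} (f : SysCochain M a) (g : SysCochain N b) (τ : Simplex κ b)
    (s t : Finset ι) :
    ((tensorCochainEquiv M N a b (f ⊗ₜ g) : ∀ τ : Simplex κ b, SysCochain ((prodSystem M N).flip.obj τ.1) a)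
        τ).ext0At s t = f.ext0At s t ⊗ₜ g τ := by
  unfold SysCochain.ext0At
  split_ifs with h
  · change (M.map (homOfLE h.2) ▷ N.obj τ.1)
      ((tensorCochainEquiv M N a b (f ⊗ₜ g) : ∀ τ : Simplex κ b, SysCochain ((prodSystem M N).flip.obj τ.1) a)
        τ ⟨s, h.1⟩) = _
    rw [tensorCochainEquiv_tmul]
    rfl
  · rw [zero_tmul]

/-- Mathlib's tensor bicomplex of the two ordered Čech complexes: `(a, b) ↦ Čᵃ(M) ⊗ Čᵇ(N)`, outer differential
`d_M ▷ Čᵇ(N)`, inner differential `Čᵃ(M) ◁ d_N` (the bicomplex whose total complex is `HomologicalComplex.tensorObj`).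
[cite: StacksProject, Tag 012K] -/
abbrev tensorBicomplex : HomologicalComplex₂ (ModuleCat.{u} A) (ComplexShape.up ℤ) (ComplexShape.up ℤ) :=
  (((curriedTensor (ModuleCat.{u} A)).mapBifunctorHomologicalComplex (ComplexShape.up ℤ) (ComplexShape.up ℤ)).obj
    (sysComplex M)).obj (sysComplex N)

omit [Fintype ι] [Fintype κ] in
/-- The inner differential of the tensor bicomplex on pure tensors: `f ⊗ g ↦ f ⊗ d g`. [cite: StacksProject, Tag 012K] -/
theorem tensorBicomplex_X_d_tmul (a b : ℤ) (f : SysCochain M a) (g : SysCochain N b) :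
    (((tensorBicomplex M N).X a).d b (b + 1)).hom (f ⊗ₜ g : SysCochain M a ⊗[A] SysCochain N b) =
      (f ⊗ₜ sysD N b g : SysCochain M a ⊗[A] SysCochain N (b + 1)) := by
  rw [Functor.mapBifunctorHomologicalComplex_obj_obj_X_d, curriedTensor_obj_map, sysComplex_d]
  rfl

omit [Fintype ι] [Fintype κ] in
/-- The outer differential of the tensor bicomplex on pure tensors: `f ⊗ g ↦ d f ⊗ g`. [cite: StacksProject, Tag 012K] -/
theorem tensorBicomplex_d_f_tmul (a b : ℤ) (f : SysCochain M a) (g : SysCochain N b) :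
    ((((tensorBicomplex M N).d a (a + 1)).f b).hom (f ⊗ₜ g : SysCochain M a ⊗[A] SysCochain N b)) =
      (sysD M a f ⊗ₜ g : SysCochain M (a + 1) ⊗[A] SysCochain N b) := by
  rw [Functor.mapBifunctorHomologicalComplex_obj_obj_d_f, curriedTensor_map_app, sysComplex_d]
  rfl

/-- **The isomorphism of bicomplexes `Č•(M) ⊠ Č•(N) ≅ Č•,•(M ⊠ N)`** between Mathlib's tensor bicomplex of the two ordered
Čech complexes (outer differential `d_M ⊗ 1`, inner `1 ⊗ d_N`) and the ordered Čech bicomplex of the product system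
(termwise `tensorCochainEquiv`; the differentials match by linearity of `⊗` in each variable).
[cite: StacksProject, Tag 0BEC] [cite: StacksProject, Tag 012K] -/
def tensorBicomplexIso : tensorBicomplex M N ≅ sysBicomplex (prodSystem M N) :=
  HomologicalComplex.Hom.isoOfComponents
    (fun a => HomologicalComplex.Hom.isoOfComponents (fun b => (tensorCochainEquiv M N a b).toModuleIso)
      (fun b b' hbb' => by
        subst hbb'
        apply ModuleCat.hom_ext
        apply TensorProduct.ext'
        intro f g
        rw [ModuleCat.hom_comp, ModuleCat.hom_comp, LinearMap.comp_apply, LinearMap.comp_apply]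
        erw [sysBicomplex_X_d_apply, tensorBicomplex_X_d_tmul]
        change sysD (cochainSystem (prodSystem M N) a) b (tensorCochainEquiv M N a b (f ⊗ₜ g)) =
          tensorCochainEquiv M N a (b + 1) (f ⊗ₜ sysD N b g)
        funext τ σ
        rw [sysD_apply, Finset.sum_apply]
        rw [tensorCochainEquiv_tmul, sysD_apply, tmul_sum]
        refine Finset.sum_congr rfl fun y _ => ?_
        change sign A _ y • (((tensorCochainEquiv M N a b (f ⊗ₜ g)).ext0At _ _ :
          SysCochain ((prodSystem M N).flip.obj _) a) σ) = _
        rw [ext0At_tensorCochainEquiv, tmul_smul]))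
    (fun a a' haa' => by
      subst haa'
      refine HomologicalComplex.hom_ext _ _ fun b => ?_
      apply ModuleCat.hom_ext
      apply TensorProduct.ext'
      intro f g
      rw [HomologicalComplex.comp_f, HomologicalComplex.comp_f, ModuleCat.hom_comp, ModuleCat.hom_comp,
        LinearMap.comp_apply, LinearMap.comp_apply]
      erw [sysBicomplex_d_f_apply, tensorBicomplex_d_f_tmul]
      change sysCochainMap (cochainSystemD (prodSystem M N) a) b (tensorCochainEquiv M N a b (f ⊗ₜ g)) =
        tensorCochainEquiv M N (a + 1) b (sysD M a f ⊗ₜ g)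
      funext τ σ
      rw [sysCochainMap_apply, cochainSystemD_app_apply, sysD_apply]
      rw [tensorCochainEquiv_tmul, sysD_apply, sum_tmul]
      refine Finset.sum_congr rfl fun y _ => ?_
      rw [ext0At_tensorCochainEquiv_apply, smul_tmul'])

/-- **`Č•(M) ⊗ Č•(N) ≅ Tot Č•,•(M ⊠ N)`**: Mathlib's tensor product of the two ordered Čech complexes
(`HomologicalComplex.tensorObj` = `Tot` of the tensor bicomplex) is the total complex of the ordered Čech bicomplex of the
product system (`HomologicalComplex₂.total.mapIso tensorBicomplexIso`). [cite: StacksProject, Tag 0BEC] [cite: StacksProject, Tag 012K] -/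
def totalTensorIso :
    HomologicalComplex.tensorObj (sysComplex M) (sysComplex N) ≅
      (sysBicomplex (prodSystem M N)).total (ComplexShape.up ℤ) :=
  HomologicalComplex₂.total.mapIso (tensorBicomplexIso M N) (ComplexShape.up ℤ)

end Tensor

end OrderedCech

end Literature.Algebra.Homology

end
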